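import Summits.QuantumFields.YangMills.Theorems.BalabanUVNodesN07ConstraintLogBridge
import Literature.MathematicalPhysics.QuantumFieldTheory.Balaban1983to89.Node00.BackgroundMapOfRecordChart
import HarnessLib

/-!
# N07 ∕ K0ᴬ — LOCATED-g28-2 ON THE ACTUAL TOKEN PACKAGE: at def-Y's scheme of record (ANY background `U₀`, ANY domain, ANY data), the KNIT tokens (rng) ∧ (star_mem) at `S.chart`
# FORCE the record's nonlinear constraint letter to VANISH at the chart point, `C_k(𝒜(V) + 𝔄(V)) = 0`, for every `V ∈ dom` whose chart image passes the averaging guard and whose exponent is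
# `SU(N)`-valued — print asks this of no configuration (its field is `T47(𝒜 + 𝔄)`, (47)∕(48))

Cell `pub-ymgap`, width seat `pub-ymgap-dag-n07-w3` (g28), INTENT-8 ∕ CLAIM-8.  `--kind proof --supports stmt-QuantumFields-27238 --as helper`; count-neutral.  Sequel of ✓p828600
`…N07ConstraintLogBridge` §4 (`COfRecord_sol_add_frakA_eq_zero_of_iterMh_eq`, stated over the holomorphic average `Ū_h` of the matrix chart field): this file reads its hypothesis `havg` off the
KNIT tokens THEMSELVES — `(rng)` at `A := S.sol V` (∈ `Kc V` by `(star_mem)`) says `Ū^k(S.chart V (S.sol V)) = V` — through the two print-true side rows that identify `↑Ū` with `Ū_h` on the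
chart image (the guard `SmallBelow`, ✓`iterMh_coeField_of_smallBelow`) and make the retraction `suOfMat` transparent (`S.expoAt V (S.sol V) b ∈ SU(N)`, def-Y's `ChartSUTok` at the point,
✓`BgScheme.coe_chart_of_mem`).  [15] = [Balaban1985Variational].

WHAT (kernel, sorry-free, standard axioms).
* ★★ `coeField_chart_eq_expOver` — on an `SU(N)`-valued exponent the matrices of def-Y's chart image ARE the (47)-FREE chart field of 3e′: `↑(S.chart V A) = expOver U₀ (η_k•evLit (A + 𝔄 V))`
  for `S = bgSchemeOfRecord …` (`rfl`-grade after ✓`coe_chart_of_mem`; the letter-level content of LOCATED-g28-2: no `T47` in the exponent).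
* ★★ `iterMh_chart_eq_of_rng` — (rng)'s average conjunct at a chart point + guard + `SU`-valuedness ⟹ `Ū^k_h(expOver U₀ (η•evLit (A + 𝔄 V))) = ↑V`.
* ★★★ `COfRecord_eq_zero_of_knitTokens` — **(rng) ∧ (star_mem) ⟹ `C_k(𝒜(V) + 𝔄(V)) = 0`** at every `V ∈ S.dom` with the two side rows, under the EL hypotheses that give the scheme's LINEAR
  constraint (`Regime 𝔊 0 W …`, `‖J‖ ≤ j`, `‖𝔄 V‖ < a𝔄`, `FrakGSliceTok`) — by ✓`COfRecord_sol_add_frakA_eq_zero_of_iterMh_eq`.  So every inhabitant of the KNIT package at def-Y's chart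
  certifies `C_k ∘ (𝒜 + 𝔄) = 0` on (the guarded, real part of) `dom`: a statement about the BCH defect of the record's block averaging along the fixed point that nobody claims and print contradicts
  in structure ((44): `C` is the genuinely nonlinear part of `Q(ηA)`); the NUMBER `C_k ∘ (𝒜 + 𝔄) ≢ 0` near `Ū^kU₀` stays OWED (memo `LOCATED-CHART-T47.g28.md`, evidence #9 on ⟨27238⟩).

HONEST LABELS.  An implication between DISPLAYED hypotheses, all kernel-true; no refutation is claimed; the side rows (guard, `SU`-valued exponent) are print-true properties of a genuine small-field
chart point ([15] (9)–(10), (19)); nothing of Bałaban's estimates; def-Y's chart letters untouched (their custody; cure = the `T47`-chart, (A4) deferred per №608); K0ᴬ ⟨27238⟩ NOT closed ∕ NOT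
refuted; N07 NOT discharged; R4 is the conditional finite-𝕋⁴ rung `BalabanLadder.UV` only; finite torus, fixed `ε` — nothing continuum ∕ OS ∕ Clay.  **The Yang–Mills mass gap is NOT proved by
any of this.**  No `sorry`, no `def`, no `instance ∕ notation`; standard axioms.
-/

set_option autoImplicit false

noncomputable section

open scoped Matrix Matrix.Norms.L2Operator InnerProductSpace

namespace Summit.QuantumFields.YangMills.Theorems.N07KnitTokensForceCZero

open Literature.MathematicalPhysics.QuantumFieldTheory.Balaban1983to89
open Literature.MathematicalPhysics.QuantumFieldTheory.Balaban1983to89.T4Continuum (T4Family)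
open Literature.MathematicalPhysics.QuantumFieldTheory.Balaban1983to89.Node00
open NormedSpace (exp)
open B15AveragingHolomorphic (iterMh)
open B11Eq103H1Complex (SiteL2K BondL2K)
open B11Eq174Chart (Regime)
open Summit.QuantumFields.YangMills.Theorems.N07ConstraintLogBridge (COfRecord_sol_add_frakA_eq_zero_of_iterMh_eq)

section Record

variable (F : T4Family) (N : ℕ) [NeZero N] (K : ℕ) (k : ℕ) (Ω : ℕ → Set (Site (F.P K) 0)) (U₀ : GaugeField (F.P K) 0 (SU N))
  [Fact (0 < (F.L : ℝ))] [Fact (0 < (F.P K).eta k)] [Fact (0 < c0Rec F K k)] [Fact (∀ c, 0 < wBRec F K k c)]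
  (dom : Set (GaugeField (F.P K) k (SU N))) (levB : PBond (F.P K) k → ℕ)
  (Gp : SiteL2K ℂ (F.P K).d (fun _ => (F.P K).sitesPerDir 0) (c0Rec F K k) (WRec N) →ₗ[ℂ]
    SiteL2K ℂ (F.P K).d (fun _ => (F.P K).sitesPerDir 0) (c0Rec F K k) (WRec N))
  (Δ2 : BondL2K ℂ (F.P K).d (fun _ => (F.P K).sitesPerDir 0) (c0Rec F K k) (WRec N) →ₗ[ℂ]
    BondL2K ℂ (F.P K).d (fun _ => (F.P K).sitesPerDir 0) (c0Rec F K k) (WRec N)) (a : ℝ)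
  (hposπ : ∀ x, x ≠ 0 → 0 < RCLike.re ⟪x, laplaceAOfRecordAt F N k U₀ (hessOpOfRecord128 F N k U₀ Gp (QflatOfRecord F N k) Δ2)
    (QOfRecord F N k U₀) (QflatOfRecord F N k) a x⟫_ℂ)
  (hposb : ∀ x, x ≠ 0 → 0 < RCLike.re ⟪x, laplaceAOfRecord F N k U₀ (QOfRecord F N k U₀) (QflatOfRecord F N k) a x⟫_ℂ)
  (hQ : Function.Surjective (QOfRecord F N k U₀)) (εC B₀ C₄ a₃ j a𝔄 ε₄ : ℝ)

/-- ★★ **THE MATRICES OF def-Y's CHART IMAGE ARE THE (47)-FREE CHART FIELD**: on an `SU(N)`-valued exponent, `↑(S.chart V A) = expOver U₀ (η_k•evLit (A + 𝔄 V))` for the scheme of record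
(`S.ev = η_k•evLit`, `S.bg V = U₀`, `suOfMat` transparent by ✓`coe_chart_of_mem`). [cite: Balaban1985Variational, (15) p.280, (19) p.281, (47) p.285 (absent here)] -/
theorem coeField_chart_eq_expOver (V : GaugeField (F.P K) k (SU N)) (A : Space115Lit F N K k Ω U₀)
    (hSU : ∀ b, (bgSchemeOfRecord F N K k Ω U₀ dom levB Gp Δ2 a hposπ hposb hQ εC B₀ C₄ a₃ j a𝔄 ε₄).expoAt V A b ∈ Matrix.specialUnitaryGroup (Fin N) ℂ) :
    coeField ((bgSchemeOfRecord F N K k Ω U₀ dom levB Gp Δ2 a hposπ hposb hQ εC B₀ C₄ a₃ j a𝔄 ε₄).chart V A) =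
      expOver U₀ ((((F.P K).eta k : ℝ) : ℂ) • evLit F N K k Ω U₀ (A + frakAOfRecordAtBg128 F N K k Ω U₀ levB Gp Δ2 a hposπ hQ V)) := by
  funext b
  rw [coeField_apply, BgScheme.coe_chart_of_mem _ (hSU b), expOver_apply]
  rfl

/-- ★★ **(rng)'s AVERAGE CONJUNCT AT A CHART POINT, READ ON THE HOLOMORPHIC AVERAGE**: `Ū^k(S.chart V A) = V` + the guard below `k` for the chart image + `SU`-valued exponent ⟹
`Ū^k_h(expOver U₀ (η•evLit (A + 𝔄 V))) = ↑V` (✓`iterMh_coeField_of_smallBelow`). [cite: Balaban1985Variational, (20) p.281; Balaban1987RG1, (0.4) p.253, (0.21) p.256] -/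
theorem iterMh_chart_eq_of_rng (V : GaugeField (F.P K) k (SU N)) (A : Space115Lit F N K k Ω U₀)
    (hSU : ∀ b, (bgSchemeOfRecord F N K k Ω U₀ dom levB Gp Δ2 a hposπ hposb hQ εC B₀ C₄ a₃ j a𝔄 ε₄).expoAt V A b ∈ Matrix.specialUnitaryGroup (Fin N) ℂ)
    (hguard : SmallBelow (avOfRecord F N K) k ((bgSchemeOfRecord F N K k Ω U₀ dom levB Gp Δ2 a hposπ hposb hQ εC B₀ C₄ a₃ j a𝔄 ε₄).chart V A))
    (hrng : Averaging.iter (avOfRecord F N K) k ((bgSchemeOfRecord F N K k Ω U₀ dom levB Gp Δ2 a hposπ hposb hQ εC B₀ C₄ a₃ j a𝔄 ε₄).chart V A) = V) :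
    iterMh k (expOver U₀ ((((F.P K).eta k : ℝ) : ℂ) • evLit F N K k Ω U₀ (A + frakAOfRecordAtBg128 F N K k Ω U₀ levB Gp Δ2 a hposπ hQ V))) = coeField V := by
  rw [← coeField_chart_eq_expOver F N K k Ω U₀ dom levB Gp Δ2 a hposπ hposb hQ εC B₀ C₄ a₃ j a𝔄 ε₄ V A hSU, iterMh_coeField_of_smallBelow F N k _ hguard, hrng]

/-- ★★★ **LOCATED-g28-2 ON THE ACTUAL TOKEN PACKAGE**: at def-Y's scheme of record `S` (any background, any domain, any data) the KNIT tokens (rng) ∧ (star_mem) — for ANY `Kc` — force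
`C_k(𝒜(V) + 𝔄(V)) = 0` at every `V ∈ S.dom` whose chart image `S.chartCfg V = S.chart V (S.sol V)` passes the guard below `k` and has an `SU(N)`-valued exponent, under the EL hypotheses of
✓`bgSchemeOfRecord_Q_chart` (the scheme's LINEAR constraint).  Print's configuration is `exp(iη·T47(𝒜 + 𝔄))·U₀` ((47)∕(48)), for which no such vanishing is implied.
[cite: Balaban1985Variational, Thm 1 p.279, (20) p.281, (44) p.285, (47)–(48) p.285, (109) p.294, Prop. 6 (116) p.295; Balaban1987RG1, (0.21) p.256] -/
theorem COfRecord_eq_zero_of_knitTokens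
    (R : Regime (frakGOfRecordAtBg128 F N K k Ω U₀ Gp Δ2 a hposπ hQ) (0 : Space115Lit F N K k Ω U₀ →L[ℂ] Space115Lit F N K k Ω U₀)
      (WOfRecordAt F N K k Ω U₀ levB a hposb hQ εC Gp) B₀ 0 C₄ a₃ j a𝔄 ε₄)
    (hJ : ‖JOfRecordAtBg F N K k Ω U₀‖ ≤ j) (h𝔊 : FrakGSliceTok F N K k Ω U₀ Gp Δ2 a hposπ hQ) {ε : ℝ}
    (Kc : GaugeField (F.P K) k (SU N) → Set (Space115Lit F N K k Ω U₀))
    (range : ∀ V ∈ (bgSchemeOfRecord F N K k Ω U₀ dom levB Gp Δ2 a hposπ hposb hQ εC B₀ C₄ a₃ j a𝔄 ε₄).dom, ∀ A ∈ Kc V,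
      (bgSchemeOfRecord F N K k Ω U₀ dom levB Gp Δ2 a hposπ hposb hQ εC B₀ C₄ a₃ j a𝔄 ε₄).chart V A ∈ bgReg F N K k ε ∧
        Averaging.iter (avOfRecord F N K) k ((bgSchemeOfRecord F N K k Ω U₀ dom levB Gp Δ2 a hposπ hposb hQ εC B₀ C₄ a₃ j a𝔄 ε₄).chart V A) = V)
    (star_mem : ∀ V ∈ (bgSchemeOfRecord F N K k Ω U₀ dom levB Gp Δ2 a hposπ hposb hQ εC B₀ C₄ a₃ j a𝔄 ε₄).dom,
      (bgSchemeOfRecord F N K k Ω U₀ dom levB Gp Δ2 a hposπ hposb hQ εC B₀ C₄ a₃ j a𝔄 ε₄).sol V ∈ Kc V)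
    {V : GaugeField (F.P K) k (SU N)} (hV : V ∈ dom) (h𝔄 : ‖frakAOfRecordAtBg128 F N K k Ω U₀ levB Gp Δ2 a hposπ hQ V‖ < a𝔄)
    (hSU : ∀ b, (bgSchemeOfRecord F N K k Ω U₀ dom levB Gp Δ2 a hposπ hposb hQ εC B₀ C₄ a₃ j a𝔄 ε₄).expoAt V
      ((bgSchemeOfRecord F N K k Ω U₀ dom levB Gp Δ2 a hposπ hposb hQ εC B₀ C₄ a₃ j a𝔄 ε₄).sol V) b ∈ Matrix.specialUnitaryGroup (Fin N) ℂ)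
    (hguard : SmallBelow (avOfRecord F N K) k ((bgSchemeOfRecord F N K k Ω U₀ dom levB Gp Δ2 a hposπ hposb hQ εC B₀ C₄ a₃ j a𝔄 ε₄).chart V
      ((bgSchemeOfRecord F N K k Ω U₀ dom levB Gp Δ2 a hposπ hposb hQ εC B₀ C₄ a₃ j a𝔄 ε₄).sol V))) :
    COfRecord F N K k Ω U₀ levB
        ((bgSchemeOfRecord F N K k Ω U₀ dom levB Gp Δ2 a hposπ hposb hQ εC B₀ C₄ a₃ j a𝔄 ε₄).sol V + frakAOfRecordAtBg128 F N K k Ω U₀ levB Gp Δ2 a hposπ hQ V) = 0 := by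
  have hdom : V ∈ (bgSchemeOfRecord F N K k Ω U₀ dom levB Gp Δ2 a hposπ hposb hQ εC B₀ C₄ a₃ j a𝔄 ε₄).dom := hV
  have hrng := (range V hdom _ (star_mem V hdom)).2
  have havg := iterMh_chart_eq_of_rng F N K k Ω U₀ dom levB Gp Δ2 a hposπ hposb hQ εC B₀ C₄ a₃ j a𝔄 ε₄ V _ hSU hguard hrng
  exact COfRecord_sol_add_frakA_eq_zero_of_iterMh_eq F N K k Ω U₀ levB a hposb hQ Gp Δ2 hposπ dom R hJ h𝔄 h𝔊 havg

end Record

end Summit.QuantumFields.YangMills.Theorems.N07KnitTokensForceCZero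

end
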